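import Summits.BirchSwinnertonDyer.BirchSwinnertonDyer.Theses.ResidualThetaTransportAtTwo
import Summits.BirchSwinnertonDyer.BirchSwinnertonDyer.Theorems.ResidualThetaTransportAtTwoRlfOfTwistedEventualLevelDescent
import Summits.BirchSwinnertonDyer.BirchSwinnertonDyer.Theorems.ResidualThetaTransportAtTwoRlfTwistedAmbientGeneric
import HarnessLib

/-!
# Item 23110 `ResidualLambdaFormulaNegDiscAtTwo` BY NAME from PRINT {weak Leopoldt at `2`, Prop. 4.12} + the EVENTUAL-level twisted
# lifting package (LIFT⁺₂ ∧ (TCAS-K)_ev for generic odd `u`) — the leaf door of road T with the twisted local `Γ`-descent at `S₀`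
# DISCHARGED (the `χ_u`-twin of `…RlfOfTwistedDescentDoor`, p655276)

Route `ResidualThetaTransportAtTwo` (RTT, crux r201, stmt-BirchSwinnertonDyer-23110) / `ThetaPartnerAtTwo` (TP2, aside r205). Seat
`prover-bsd-wall-tp2-p2x-w3` g12 (the lead tp2-p2x g12's (R6) ask (D)); `--supports stmt-BirchSwinnertonDyer-23110`. THEOREMS ONLY; LEAF
file (imports the route file and route-independent helpers only).

* `residualLambdaFormulaNegDiscAtTwo_of_print_of_twistedEventualLevelLift` — (hWL) → (h412) → «for every (κ, γ, S₀, E) of the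
  branch: ∃ B finite, ∀ odd u ∉ B, LIFT⁺₂(u) ∧ (TCAS-K)_ev(u)» → **`Theses.ResidualThetaTransportAtTwo.ResidualLambdaFormulaNegDiscAtTwo`**
  BY NAME (`c = 0`): choose `u` outside `B` and the finite exceptional set of `TwistedSurj.exists_twistedCoinv_H1Sigma_of_print` (ii),
  then `rlf2_of_twistedEventualLevelDescent`;
* `residualLambdaFormulaNegDiscAtTwo_TP2_of_print_of_twistedEventualLevelLift` — the same for the TP2 decl (identical text).

STATE OF 23110 AFTER THIS FILE: every rank ⟸ PRINT {WL@2, Prop. 4.12} (route binders) + (LIFT⁺₂) [= (R3) twisted `+`-local lift at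
`2`, this seat's `…RlfTwistedPlusLocShift` / `…RlfTwistedPlusLocEngine`, + PT over `ℚ`] + (TCAS-K)_ev [= (R5'), Greenberg's Prop. 4.13
for `A_s` at finite levels over `ℚ`, the lead's lane] — the twisted local `Γ`-descent at `S₀` is no longer displayed.
HONEST FRAMING: CONDITIONAL; closes nothing; BSD is not proved by any of this.
References: [GreenbergLNM1716] §4 Props. 4.12–4.14 (pp. 119–124); [GreenbergVatsal2000] §2 Prop. (2.1), (10); [BDKim2013] Thm. 1.1.
-/

set_option autoImplicit false
set_option linter.dupNamespace false

noncomputable section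

open scoped Classical NumberField AddSubgroup

open NumberField IsDedekindDomain

namespace Summit.BirchSwinnertonDyer.BirchSwinnertonDyer.Theorems.SignedEC.TwistedLocalDescent

open Literature.NumberTheory.EllipticCurves Literature.NumberTheory.GaloisRepresentations
  WeierstrassCurve ZpExtension Literature.NumberTheory.EllipticCurves.Kobayashi2003
  Literature.NumberTheory.EllipticCurves.GreenbergVatsal2000 Literature.NumberTheory.EllipticCurves.GreenbergSelmer
  Literature.NumberTheory.EllipticCurves.Rank1Residual

/-- **Item 23110 BY NAME from print + the eventual-level twisted-lifting package.** Granted the routes' PUB binders weak Leopoldt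
(`Greenberg1999.h1SigmaInfty_rank_eq_one`) and Prop. 4.12 (`Greenberg1999.prop412_noFiniteSubmodule_H1Sigma_of_rank_one`) BY NAME, and —
for every cyclotomic datum, every admissible `S₀` and every curve `E` of the branch — «(LIFT⁺₂)(u) ∧ (TCAS-K)_ev(u) for all odd `u` outside
a finite set», the route decl `ResidualLambdaFormulaNegDiscAtTwo` holds with `c = 0`. CONDITIONAL; closes nothing.
[cite: GreenbergLNM1716, §4 Props. 4.12–4.14 (pp. 119–124)] [cite: GreenbergVatsal2000, §2 Prop. (2.1) and (10)] [cite: BDKim2013, Thm. 1.1] -/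
theorem residualLambdaFormulaNegDiscAtTwo_of_print_of_twistedEventualLevelLift (hWL : Greenberg1999.h1SigmaInfty_rank_eq_one)
    (h412 : Greenberg1999.prop412_noFiniteSubmodule_H1Sigma_of_rank_one)
    (hTL : ∀ (κ : ZpExtension ℚ 2) (γ : Field.absoluteGaloisGroup ℚ), κ.IsCyclotomic → κ.IsTopGenerator γ →
      ∀ (S₀ : Finset (HeightOneSpectrum (𝓞 ℚ))), (∀ v ∈ S₀, ((2 : ℕ) : 𝓞 ℚ) ∉ v.asIdeal) →
      ∀ (E : WeierstrassCurve ℚ) [E.IsElliptic] [E.IsGloballyMinimal], GoodSS E 2 → E.frobeniusTrace 2 = 0 → E.Δ < 0 →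
        (∀ v : HeightOneSpectrum (𝓞 ℚ), ¬ E.HasGoodReductionAt v → v ∈ S₀) →
      ∃ B : Set ℤ, B.Finite ∧ ∀ u : ℤ, u ∉ B → ∀ hu : ((2 : ℕ) : ℤ) ∣ u - 1,
        (∀ c ∈ unramifiedOutside κ.kerSubgroup ↥(E.geomPrimaryTorsion 2) 2 (↑S₀ : Set (HeightOneSpectrum (𝓞 ℚ))),
      u • E.conjH1 2 κ.kerSubgroup γ c - c ∈
        ⨅ (v : HeightOneSpectrum (𝓞 ℚ)) (_ : ((2 : ℕ) : 𝓞 ℚ) ∈ v.asIdeal) (σ : Field.absoluteGaloisGroup ℚ),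
          (localKummerOverOfEmb E 2 κ.kerSubgroup (closureEmb (K := ℚ) (v.adicCompletion ℚ))
            (⨆ n : ℕ, signedLocalPoints κ (v.adicCompletion ℚ) E 1 n)).comap (E.conjH1 2 κ.kerSubgroup σ) →
      ∃ c' ∈ unramifiedOutside κ.kerSubgroup ↥(E.geomPrimaryTorsion 2) 2 (↑S₀ : Set (HeightOneSpectrum (𝓞 ℚ))),
        u • E.conjH1 2 κ.kerSubgroup γ c' = c' ∧ c - c' ∈
          ⨅ (v : HeightOneSpectrum (𝓞 ℚ)) (_ : ((2 : ℕ) : 𝓞 ℚ) ∈ v.asIdeal) (σ : Field.absoluteGaloisGroup ℚ),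
            (localKummerOverOfEmb E 2 κ.kerSubgroup (closureEmb (K := ℚ) (v.adicCompletion ℚ))
              (⨆ n : ℕ, signedLocalPoints κ (v.adicCompletion ℚ) E 1 n)).comap (E.conjH1 2 κ.kerSubgroup σ)) ∧
        (∀ (J : ℕ) (t : ∀ v : HeightOneSpectrum (𝓞 ℚ),
        galoisCohomology ((E.twistedTorsionGaloisModule 2 κ J u hu).restrictField (v.adicCompletion ℚ)) 1),
      ∃ (J' : ℕ) (hJ : J ≤ J') (x : galoisCohomology (E.twistedTorsionGaloisModule 2 κ J' u hu) 1),
        E.twistedTorsionToH1 2 κ J' u hu x ∈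
            unramifiedOutside κ.kerSubgroup ↥(E.geomPrimaryTorsion 2) 2 (↑S₀ : Set (HeightOneSpectrum (𝓞 ℚ))) ⊓
              ⨅ (v : HeightOneSpectrum (𝓞 ℚ)) (_ : ((2 : ℕ) : 𝓞 ℚ) ∈ v.asIdeal) (σ : Field.absoluteGaloisGroup ℚ),
                (localKummerOverOfEmb E 2 κ.kerSubgroup (closureEmb (K := ℚ) (v.adicCompletion ℚ))
                  (⨆ n : ℕ, signedLocalPoints κ (v.adicCompletion ℚ) E 1 n)).comap (E.conjH1 2 κ.kerSubgroup σ) ∧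
          ∀ v ∈ S₀, galoisCohomology.res (E.twistedTorsionGaloisModule 2 κ J' u hu) (v.adicCompletion ℚ) 1 x =
            galoisCohomology.map ((E.twistedTorsionIncl 2 κ hJ u hu).restrictField (v.adicCompletion ℚ)) 1 (t v))) :
    Summit.BirchSwinnertonDyer.BirchSwinnertonDyer.Theses.ResidualThetaTransportAtTwo.ResidualLambdaFormulaNegDiscAtTwo := by
  intro κ γ hκ hγ S₀ hS2
  refine ⟨0, fun E _ _ hss ha hΔ hS D _ hX hμ ↦ ?_⟩
  obtain ⟨B, hB, hTLu⟩ := hTL κ γ hκ hγ S₀ hS2 E hss ha hΔ hS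
  have hgood : ∀ v : HeightOneSpectrum (𝓞 ℚ), v ∉ S₀ → ((2 : ℕ) : 𝓞 ℚ) ∉ v.asIdeal → E.HasGoodReductionAt v :=
    fun v hv _ ↦ by by_contra hng; exact hv (hS v hng)
  obtain ⟨u, huB, hu, hH⟩ := TwistedSurj.exists_twistedCoinv_H1Sigma_of_print hWL h412 E 2 κ γ hκ hγ S₀ hgood B hB
  have hu' : ((2 : ℕ) : ℤ) ∣ u - 1 := by exact_mod_cast hu
  obtain ⟨hlift, hlev⟩ := hTLu u huB hu'
  simpa only [Nat.add_zero] using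
    rlf2_of_twistedEventualLevelDescent κ γ hκ hγ S₀ hS2 E hss ha hΔ hS D hX hμ hu' hH hlift hlev

/-- **The same for the TP2 decl** `Theses.ThetaPartnerAtTwo.ResidualLambdaFormulaNegDiscAtTwo` (identical text).
[cite: GreenbergLNM1716, §4 Props. 4.12–4.14 (pp. 119–124)] [cite: GreenbergVatsal2000, §2 Prop. (2.1) and (10)] -/
theorem residualLambdaFormulaNegDiscAtTwo_TP2_of_print_of_twistedEventualLevelLift (hWL : Greenberg1999.h1SigmaInfty_rank_eq_one)
    (h412 : Greenberg1999.prop412_noFiniteSubmodule_H1Sigma_of_rank_one)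
    (hTL : ∀ (κ : ZpExtension ℚ 2) (γ : Field.absoluteGaloisGroup ℚ), κ.IsCyclotomic → κ.IsTopGenerator γ →
      ∀ (S₀ : Finset (HeightOneSpectrum (𝓞 ℚ))), (∀ v ∈ S₀, ((2 : ℕ) : 𝓞 ℚ) ∉ v.asIdeal) →
      ∀ (E : WeierstrassCurve ℚ) [E.IsElliptic] [E.IsGloballyMinimal], GoodSS E 2 → E.frobeniusTrace 2 = 0 → E.Δ < 0 →
        (∀ v : HeightOneSpectrum (𝓞 ℚ), ¬ E.HasGoodReductionAt v → v ∈ S₀) →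
      ∃ B : Set ℤ, B.Finite ∧ ∀ u : ℤ, u ∉ B → ∀ hu : ((2 : ℕ) : ℤ) ∣ u - 1,
        (∀ c ∈ unramifiedOutside κ.kerSubgroup ↥(E.geomPrimaryTorsion 2) 2 (↑S₀ : Set (HeightOneSpectrum (𝓞 ℚ))),
      u • E.conjH1 2 κ.kerSubgroup γ c - c ∈
        ⨅ (v : HeightOneSpectrum (𝓞 ℚ)) (_ : ((2 : ℕ) : 𝓞 ℚ) ∈ v.asIdeal) (σ : Field.absoluteGaloisGroup ℚ),
          (localKummerOverOfEmb E 2 κ.kerSubgroup (closureEmb (K := ℚ) (v.adicCompletion ℚ))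
            (⨆ n : ℕ, signedLocalPoints κ (v.adicCompletion ℚ) E 1 n)).comap (E.conjH1 2 κ.kerSubgroup σ) →
      ∃ c' ∈ unramifiedOutside κ.kerSubgroup ↥(E.geomPrimaryTorsion 2) 2 (↑S₀ : Set (HeightOneSpectrum (𝓞 ℚ))),
        u • E.conjH1 2 κ.kerSubgroup γ c' = c' ∧ c - c' ∈
          ⨅ (v : HeightOneSpectrum (𝓞 ℚ)) (_ : ((2 : ℕ) : 𝓞 ℚ) ∈ v.asIdeal) (σ : Field.absoluteGaloisGroup ℚ),
            (localKummerOverOfEmb E 2 κ.kerSubgroup (closureEmb (K := ℚ) (v.adicCompletion ℚ))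
              (⨆ n : ℕ, signedLocalPoints κ (v.adicCompletion ℚ) E 1 n)).comap (E.conjH1 2 κ.kerSubgroup σ)) ∧
        (∀ (J : ℕ) (t : ∀ v : HeightOneSpectrum (𝓞 ℚ),
        galoisCohomology ((E.twistedTorsionGaloisModule 2 κ J u hu).restrictField (v.adicCompletion ℚ)) 1),
      ∃ (J' : ℕ) (hJ : J ≤ J') (x : galoisCohomology (E.twistedTorsionGaloisModule 2 κ J' u hu) 1),
        E.twistedTorsionToH1 2 κ J' u hu x ∈
            unramifiedOutside κ.kerSubgroup ↥(E.geomPrimaryTorsion 2) 2 (↑S₀ : Set (HeightOneSpectrum (𝓞 ℚ))) ⊓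
              ⨅ (v : HeightOneSpectrum (𝓞 ℚ)) (_ : ((2 : ℕ) : 𝓞 ℚ) ∈ v.asIdeal) (σ : Field.absoluteGaloisGroup ℚ),
                (localKummerOverOfEmb E 2 κ.kerSubgroup (closureEmb (K := ℚ) (v.adicCompletion ℚ))
                  (⨆ n : ℕ, signedLocalPoints κ (v.adicCompletion ℚ) E 1 n)).comap (E.conjH1 2 κ.kerSubgroup σ) ∧
          ∀ v ∈ S₀, galoisCohomology.res (E.twistedTorsionGaloisModule 2 κ J' u hu) (v.adicCompletion ℚ) 1 x =
            galoisCohomology.map ((E.twistedTorsionIncl 2 κ hJ u hu).restrictField (v.adicCompletion ℚ)) 1 (t v))) :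
    Summit.BirchSwinnertonDyer.BirchSwinnertonDyer.Theses.ThetaPartnerAtTwo.ResidualLambdaFormulaNegDiscAtTwo :=
  residualLambdaFormulaNegDiscAtTwo_of_print_of_twistedEventualLevelLift hWL h412 hTL

end Summit.BirchSwinnertonDyer.BirchSwinnertonDyer.Theorems.SignedEC.TwistedLocalDescent

end
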